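/-
Width seat `ym-line-sgb-p1-w3` (seat prover-ym-line-sgb-p1-w3-g0-0), route `SteinGapBootstrap`, SUPPORT item `PolySmallFieldsG`
(stmt-QuantumFields-23000): the route decl, BY NAME.
-/
import Summits.QuantumFields.YangMills.Theses.SteinGapBootstrap
import Summits.QuantumFields.YangMills.Theorems.EquipartitionCriticalityEquipartitionPinsProbeEquipartition
import Summits.QuantumFields.YangMills.Theorems.EquipartitionCriticalityFreeEnergyLogCoefficient
import Summits.QuantumFields.YangMills.Theorems.EquipartitionCriticalityEquipartitionPinsProbeTangentPlaquetteEnergy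
import Summits.QuantumFields.YangMills.Theorems.EquipartitionCriticalityEquipartitionPinsProbeTangentCombPoincare
import HarnessLib

/-!
# Route `SteinGapBootstrap`, support item `PolySmallFieldsG` (stmt-QuantumFields-23000) — PROVED

NOT THE CLAY GAP (a support item of a line on the RECORD-label rung leaf `WeakCouplingRates.XiPow`; no summit statement is touched).

`Summit.QuantumFields.YangMills.Theses.SteinGapBootstrap.PolySmallFieldsG`: for every compact simple `G` and faithful unitary lattice
representation `r` there are `C₀, β₀` such that for `β ≥ β₀`, every torus-limit state `μ ∈ infiniteVolumeLimitPoints r.ρ β` (`d = 4`)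
and every plaquette `(x; i, j)`, `i ≠ j`: `∫ (N − Re tr r(U_{(x;i,j)})) dμ ≤ C₀ / β` (polynomially small fields / equipartition bound).

Proof (the refuter's recipe on the item, all inputs in the tree):
* `EquipartitionPinsProbe.stub_equipartition` fed by `freeEnergyLogCoefficient_proof` (route `EquipartitionCriticality`): for `ε = 1`,
  eventually in `β`, uniformly over the limit states, `|β · E_μ[s₀] − 3D/2| < 1` for the origin site energy
  `s₀ = ∑_{i<j} (N − Re tr r(U_{(0;i,j)}))`; hence `E_μ[s₀] ≤ (3D/2 + 1)/β` for `β ≥ max β₁ 1`;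
* each summand is non-negative (`TangentPlaquetteEnergy.sub_plaquetteObs_nonneg`, unitarity) so a single plane `i < j` at the origin is
  dominated by the site energy (`sub_plaquetteObs_le_siteSum`, `integral_mono`);
* `j < i` is the same number (the reversed plaquette has the inverse holonomy; `Re tr r(g⁻¹) = Re tr r(g)` for unitary `r`,
  `TangentCombPoincare.re_trace_map_inv`);
* a general base point `x` is reduced to the origin by translation invariance of torus-limit states (B-TI,
  `WeakCouplingRates.integral_comp_configShift_of_mem_limitPoints`, `plaquetteObs_configShift`).
`C₀ := 3D/2 + 1`, `β₀ := max β₁ 1`.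

References: S. Chatterjee, arXiv:1602.01222 (free energy leading term) [Chatterjee2016]; E. Seiler, LNP 159 (1982) Ch. 2 [SeilerLNP1982];
R. B. Griffiths, J. Math. Phys. 5 (1964) / D. Ruelle, Statistical Mechanics (1969) (energy densities are subgradients of the pressure).
-/

set_option autoImplicit false

noncomputable section

open MeasureTheory Filter
open Literature.MathematicalPhysics
open Literature.MathematicalPhysics.QuantumLattice
open Literature.MathematicalPhysics.QuantumFieldTheory
open Summit.QuantumFields.YangMills.Theorems.WeakCouplingRates
open Summit.QuantumFields.YangMills.Theorems.EquipartitionPinsProbe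

namespace Summit.QuantumFields.YangMills.Theorems.SteinGapBootstrap

section Plaquette

variable {G : Type} [Group G] {N : ℕ} (ρ : G →* Matrix (Fin N) (Fin N) ℂ)

/-- Reversing the orientation of a plaquette of `ℤ⁴` inverts its holonomy. -/
theorem plaquetteHolonomyZd_rev (U : LGConfig 4 G) (x : Literature.Probability.LatticeModels.Site 4) (i j : Fin 4) :
    plaquetteHolonomyZd U x j i = (plaquetteHolonomyZd U x i j)⁻¹ := by
  simp only [plaquetteHolonomyZd, mul_inv_rev, inv_inv, mul_assoc]

/-- For a unitary-valued model the plaquette observable does not see the orientation of the plaquette: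
`Re tr ρ(U_{(x;j,i)}) = Re tr ρ(U_{(x;i,j)})`. -/
theorem plaquetteObs_rev (hρu : ∀ g, ρ g ∈ Matrix.unitaryGroup (Fin N) ℂ) (U : LGConfig 4 G)
    (x : Literature.Probability.LatticeModels.Site 4) (i j : Fin 4) :
    plaquetteObs ρ x j i U = plaquetteObs ρ x i j U := by
  simp only [plaquetteObs]
  rw [plaquetteHolonomyZd_rev, TangentCombPoincare.re_trace_map_inv ρ hρu]

end Plaquette

/-- **Support item `PolySmallFieldsG` of route `SteinGapBootstrap` (stmt-QuantumFields-23000), by name**: equipartition bound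
`∫ (N − Re tr r(U_p)) dμ ≤ C₀/β` at every plaquette, for `β ≥ β₀` and every torus-limit state, every compact simple `G` and faithful
unitary `r` (`C₀ = 3D/2 + 1`).  From the tree's `stub_equipartition ∘ freeEnergyLogCoefficient_proof`, non-negativity of the
plaquette energies, orientation symmetry and B-TI.  NOT THE CLAY GAP. -/
theorem PolySmallFieldsG_proof : Summit.QuantumFields.YangMills.Theses.SteinGapBootstrap.PolySmallFieldsG := by
  intro G _ _ _ _ hG
  letI : MeasurableSpace G := borel G
  haveI : BorelSpace G := ⟨rfl⟩
  intro r
  haveI : SecondCountableTopology G :=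
    (r.continuous.isClosedEmbedding r.injective).isEmbedding.secondCountableTopology
  -- equipartition of the origin site energy, uniformly over limit states, at tolerance 1
  obtain ⟨c, hc0, hev⟩ : ∃ c : ℝ, 0 ≤ c ∧ ∀ᶠ β : ℝ in atTop,
      ∀ μ ∈ infiniteVolumeLimitPoints (d := 4) r.ρ β,
        |β * (∫ U, (∑ i : Fin 4, ∑ j : Fin 4,
            if i < j then ((r.N : ℝ) - plaquetteObs r.ρ 0 i j U) else 0) ∂μ) - c| < 1 :=
    ⟨_, by positivity, stub_equipartition G hG r
      (Summit.QuantumFields.YangMills.Theorems.freeEnergyLogCoefficient_proof G hG r) 1 one_pos⟩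
  obtain ⟨β₁, hβ₁⟩ := Filter.eventually_atTop.1 hev
  refine ⟨c + 1, max β₁ 1, fun β hβ μ hμ x i j hij => ?_⟩
  have hβ1 : 1 ≤ β := (le_max_right _ _).trans hβ
  have hβ0 : 0 < β := one_pos.trans_le hβ1
  haveI : IsProbabilityMeasure μ := by obtain ⟨_, _, hprob, _⟩ := hμ; exact hprob
  -- the origin site energy is at most `(c + 1)/β`
  have hsite : ∫ U, (∑ i : Fin 4, ∑ j : Fin 4,
      if i < j then ((r.N : ℝ) - plaquetteObs r.ρ 0 i j U) else 0) ∂μ ≤ (c + 1) / β := by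
    have h := (abs_lt.1 (hβ₁ β ((le_max_left _ _).trans hβ) μ hμ)).2
    rw [le_div_iff₀ hβ0]
    linarith
  -- a single plane `i < j` at the origin
  have horigin : ∀ i j : Fin 4, i < j →
      ∫ U, ((r.N : ℝ) - plaquetteObs r.ρ 0 i j U) ∂μ ≤ (c + 1) / β := by
    intro i j hij
    refine le_trans ?_ hsite
    exact integral_mono (TangentPlaquetteEnergy.integrable_sub_plaquetteObs r.ρ r.continuous r.mem_unitary μ 0 i j)
      (TangentPlaquetteEnergy.integrable_siteSum r.ρ r.continuous r.mem_unitary μ 0)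
      fun U => TangentPlaquetteEnergy.sub_plaquetteObs_le_siteSum r.ρ r.mem_unitary 0 hij U
  -- either orientation at the origin
  have horigin' : ∀ i j : Fin 4, i ≠ j →
      ∫ U, ((r.N : ℝ) - plaquetteObs r.ρ 0 i j U) ∂μ ≤ (c + 1) / β := by
    intro i j hij
    rcases lt_or_gt_of_ne hij with h | h
    · exact horigin i j h
    · have hrev : ∀ U : LGConfig 4 G, plaquetteObs r.ρ 0 i j U = plaquetteObs r.ρ 0 j i U := fun U =>
        plaquetteObs_rev r.ρ r.mem_unitary U 0 j i
      simp_rw [hrev]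
      exact horigin j i h
  -- translate the base point to the origin (B-TI of torus-limit states)
  have hshift : ∫ U, ((r.N : ℝ) - plaquetteObs r.ρ x i j U) ∂μ =
      ∫ U, ((r.N : ℝ) - plaquetteObs r.ρ 0 i j U) ∂μ := by
    have hcyl : IsCylinder (fun U : LGConfig 4 G => (r.N : ℝ) - plaquetteObs r.ρ 0 i j U)
        (originPlaquetteSupport i j) := fun U V h =>
      congrArg (fun y : ℝ => (r.N : ℝ) - y) (isCylinder_plaquetteObs_zero r.ρ i j h)
    have h := integral_comp_configShift_of_mem_limitPoints r.ρ hμ (-x) hcyl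
      (continuous_const.sub (continuous_plaquetteObs r.ρ r.continuous 0 i j))
      ⟨2 * r.N, fun U => TangentPlaquetteEnergy.abs_sub_plaquetteObs_le r.ρ r.mem_unitary 0 i j U⟩
    rw [← h]
    refine integral_congr_ae (ae_of_all _ fun U => ?_)
    simp only [TangentPlaquetteEnergy.plaquetteObs_configShift, zero_sub, neg_neg]
  rw [hshift]
  exact horigin' i j hij

end Summit.QuantumFields.YangMills.Theorems.SteinGapBootstrap

end
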